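import Mathlib.MeasureTheory.Integral.Bochner.ContinuousLinearMap
import Mathlib.MeasureTheory.Integral.IntegrableOn
import Mathlib.Analysis.Complex.Basic
import HarnessLib

/-!
# Reflected connected correlations and Osterwalder–Schrader polarisation

Abstract measure-theoretic bookkeeping for transfer-matrix / reflection-positivity arguments
(any finite measure `μ` on `Ω`, any measurable maps `Θ, τ : Ω → Ω`; on a lattice `Θ` is a time
reflection and `τ` a time translation). All statements here are proved.

* `osCorr μ Θ τ X Y = ∫ conj X(Θω) · Y(τω) dμ − conj(∫X) ∫Y` — the reflected, translated connected
  correlation (conjugate-linear in `X`); `osVar μ Θ X = Re osCorr μ Θ id X X` — the OS variance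
  (squared norm of the OS vector of `X` minus its vacuum component);
* `osCorr_add_smul` — the sesquilinear expansion of the diagonal;
* **polarisation** `norm_osCorr_le_of_gap`: on any class of bounded measurable `X` closed under
  `X + c • Y` on which `‖osCorr τ Z Z‖ ≤ osVar Z · E` and `0 ≤ osVar Z`, one has
  `‖osCorr τ X Y‖ ≤ 2 (osVar X + osVar Y) E` — `4 osCorr(X, Y) = Σ_{c⁴ = 1} c̄ · osCorr(X + cY, X + cY)`
  and the parallelogram law. This is how a DIAGONAL lattice gap in OS currency (spectral bound of
  the transfer matrix on each vector) bounds off-diagonal connected correlations with constants —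
  OS variances — that survive continuum limits.

References: K. Osterwalder, E. Seiler, Ann. Phys. 110 (1978) 440, §2; J. Glimm, A. Jaffe, Quantum
Physics (1987), §6.1 (OS reconstruction, the form `⟨ΘF, T_t G⟩`).
-/

open scoped ComplexConjugate
open Filter MeasureTheory

noncomputable section

namespace Literature.MathematicalPhysics.QuantumLattice

section Polarization

variable {Ω : Type*} [MeasurableSpace Ω]

/-- The **reflected, translated connected correlation** `∫ conj X(Θω) · Y(τω) dμ − conj(∫X) ∫Y`
(on the lattice: `Θ` the time reflection, `τ` a time translation; conjugate-linear in `X`). [cite: OsterwalderSeiler1978, §2] -/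
def osCorr (μ : Measure Ω) (Θ τ : Ω → Ω) (X Y : Ω → ℂ) : ℂ :=
  (∫ ω, conj (X (Θ ω)) * Y (τ ω) ∂μ) - conj (∫ ω, X ω ∂μ) * ∫ ω, Y ω ∂μ

/-- The **OS variance** `Re (∫ conj X(Θω) · X(ω) dμ − |∫X|²)` — the squared norm of the OS vector of
`X` minus its vacuum component. [cite: OsterwalderSeiler1978, §2] -/
def osVar (μ : Measure Ω) (Θ : Ω → Ω) (X : Ω → ℂ) : ℝ := (osCorr μ Θ id X X).re

variable {μ : Measure Ω} [IsFiniteMeasure μ] {Θ τ : Ω → Ω}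

omit [IsFiniteMeasure μ] in
/-- Bounded measurable functions: `conj X(Θ·) · Y(τ·)` is integrable (finite measure). [folklore] -/
theorem integrable_conj_comp_mul_comp [IsFiniteMeasure μ] (hΘ : Measurable Θ) (hτ : Measurable τ)
    {X Y : Ω → ℂ} (hX : Measurable X) (hbX : ∃ B, ∀ ω, ‖X ω‖ ≤ B) (hY : Measurable Y)
    (hbY : ∃ B, ∀ ω, ‖Y ω‖ ≤ B) : Integrable (fun ω => conj (X (Θ ω)) * Y (τ ω)) μ := by
  obtain ⟨B, hB⟩ := hbX
  obtain ⟨B', hB'⟩ := hbY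
  refine Integrable.of_bound ((Complex.continuous_conj.measurable.comp (hX.comp hΘ)).mul
    (hY.comp hτ)).aestronglyMeasurable (B * B') (Eventually.of_forall fun ω => ?_)
  rw [norm_mul, RCLike.norm_conj]
  exact mul_le_mul (hB (Θ ω)) (hB' (τ ω)) (norm_nonneg _) ((norm_nonneg _).trans (hB (Θ ω)))

/-- Bounded measurable functions are integrable (finite measure). [folklore] -/
theorem integrable_of_measurable_bounded {X : Ω → ℂ} (hX : Measurable X) (hbX : ∃ B, ∀ ω, ‖X ω‖ ≤ B) :
    Integrable X μ := by
  obtain ⟨B, hB⟩ := hbX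
  exact Integrable.of_bound hX.aestronglyMeasurable B (Eventually.of_forall hB)

/-- **Sesquilinear expansion** of the diagonal: `osCorr(X + cY, X + cY) =
osCorr(X,X) + c osCorr(X,Y) + c̄ osCorr(Y,X) + c̄c osCorr(Y,Y)`. [folklore] -/
theorem osCorr_add_smul (hΘ : Measurable Θ) (hτ : Measurable τ) {X Y : Ω → ℂ} (hX : Measurable X)
    (hbX : ∃ B, ∀ ω, ‖X ω‖ ≤ B) (hY : Measurable Y) (hbY : ∃ B, ∀ ω, ‖Y ω‖ ≤ B) (c : ℂ) :
    osCorr μ Θ τ (X + c • Y) (X + c • Y) = osCorr μ Θ τ X X + c * osCorr μ Θ τ X Y +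
      conj c * osCorr μ Θ τ Y X + conj c * c * osCorr μ Θ τ Y Y := by
  have hXX := integrable_conj_comp_mul_comp (μ := μ) hΘ hτ hX hbX hX hbX
  have hXY := integrable_conj_comp_mul_comp (μ := μ) hΘ hτ hX hbX hY hbY
  have hYX := integrable_conj_comp_mul_comp (μ := μ) hΘ hτ hY hbY hX hbX
  have hYY := integrable_conj_comp_mul_comp (μ := μ) hΘ hτ hY hbY hY hbY
  have e1 : ∫ ω, conj ((X + c • Y) (Θ ω)) * (X + c • Y) (τ ω) ∂μ =
      (∫ ω, conj (X (Θ ω)) * X (τ ω) ∂μ) + c * (∫ ω, conj (X (Θ ω)) * Y (τ ω) ∂μ) +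
        conj c * (∫ ω, conj (Y (Θ ω)) * X (τ ω) ∂μ) +
        conj c * c * (∫ ω, conj (Y (Θ ω)) * Y (τ ω) ∂μ) := by
    have h : ∀ ω, conj ((X + c • Y) (Θ ω)) * (X + c • Y) (τ ω) =
        conj (X (Θ ω)) * X (τ ω) + c * (conj (X (Θ ω)) * Y (τ ω)) +
          conj c * (conj (Y (Θ ω)) * X (τ ω)) + conj c * c * (conj (Y (Θ ω)) * Y (τ ω)) := by
      intro ω
      simp only [Pi.add_apply, Pi.smul_apply, smul_eq_mul, map_add, map_mul]
      ring
    simp_rw [h]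
    have iB := hXY.const_mul c
    have iC := hYX.const_mul (conj c)
    have iD := hYY.const_mul (conj c * c)
    rw [integral_add ?_ iD, integral_add ?_ iC, integral_add hXX iB, integral_const_mul,
      integral_const_mul, integral_const_mul]
    · exact hXX.add iB
    · exact (hXX.add iB).add iC
  have e2 : ∫ ω, (X + c • Y) ω ∂μ = (∫ ω, X ω ∂μ) + c * ∫ ω, Y ω ∂μ := by
    simp only [Pi.add_apply, Pi.smul_apply, smul_eq_mul]
    rw [integral_add (integrable_of_measurable_bounded hX hbX) ((integrable_of_measurable_bounded hY hbY).const_mul c),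
      integral_const_mul]
  unfold osCorr
  rw [e1, e2]
  simp only [map_add, map_mul]
  ring

/-- **Polarisation: a diagonal OS gap bounds off-diagonal correlations.** On a class `Good` of
bounded measurable functions closed under `X + c • Y`, if `‖osCorr τ (Z, Z)‖ ≤ osVar Z · E` and
`0 ≤ osVar Z` for all good `Z` (`E ≥ 0`), then `‖osCorr τ (X, Y)‖ ≤ 2 (osVar X + osVar Y) E` for good
`X, Y`: `4 osCorr(X, Y) = Σ_{c ∈ {1,-1,i,-i}} c̄ · osCorr(X + cY, X + cY)` and
`osVar(X + cY) ≤ 2 osVar X + 2 osVar Y` (parallelogram law, `osVar(X − cY) ≥ 0`). [cite: GlimmJaffe1987, §6.1] -/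
theorem norm_osCorr_le_of_gap (hΘ : Measurable Θ) (hτ : Measurable τ) {Good : (Ω → ℂ) → Prop}
    (hmeas : ∀ X, Good X → Measurable X) (hbdd : ∀ X, Good X → ∃ B, ∀ ω, ‖X ω‖ ≤ B)
    (hadd : ∀ X Y (c : ℂ), Good X → Good Y → Good (X + c • Y)) {E : ℝ} (hE : 0 ≤ E)
    (hgap : ∀ Z, Good Z → ‖osCorr μ Θ τ Z Z‖ ≤ osVar μ Θ Z * E)
    (hvar : ∀ Z, Good Z → 0 ≤ osVar μ Θ Z) {X Y : Ω → ℂ} (hX : Good X) (hY : Good Y) :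
    ‖osCorr μ Θ τ X Y‖ ≤ 2 * (osVar μ Θ X + osVar μ Θ Y) * E := by
  have hXm := hmeas X hX
  have hXb := hbdd X hX
  have hYm := hmeas Y hY
  have hYb := hbdd Y hY
  -- parallelogram bound on the class
  have hpar : ∀ c : ℂ, ‖c‖ = 1 → osVar μ Θ (X + c • Y) ≤ 2 * osVar μ Θ X + 2 * osVar μ Θ Y := by
    intro c hc
    have hcc : conj c * c = 1 := by rw [Complex.conj_mul', hc]; simp
    have h1 := osCorr_add_smul (μ := μ) (τ := id) hΘ measurable_id hXm hXb hYm hYb c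
    have h2 := osCorr_add_smul (μ := μ) (τ := id) hΘ measurable_id hXm hXb hYm hYb (-c)
    have hnn := hvar _ (hadd X Y (-c) hX hY)
    simp only [osVar] at hnn ⊢
    rw [h1]
    rw [h2] at hnn
    simp only [map_neg, neg_mul, mul_neg, neg_neg, hcc, one_mul, Complex.add_re,
      Complex.neg_re] at hnn ⊢
    linarith
  have key : ∀ c : ℂ, ‖c‖ = 1 →
      ‖osCorr μ Θ τ (X + c • Y) (X + c • Y)‖ ≤ (2 * osVar μ Θ X + 2 * osVar μ Θ Y) * E :=
    fun c hc => (hgap _ (hadd X Y c hX hY)).trans (mul_le_mul_of_nonneg_right (hpar c hc) hE)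
  -- polarisation identity
  have hpol : (4 : ℂ) * osCorr μ Θ τ X Y =
      osCorr μ Θ τ (X + (1 : ℂ) • Y) (X + (1 : ℂ) • Y) -
        osCorr μ Θ τ (X + (-1 : ℂ) • Y) (X + (-1 : ℂ) • Y) -
        Complex.I * osCorr μ Θ τ (X + Complex.I • Y) (X + Complex.I • Y) +
        Complex.I * osCorr μ Θ τ (X + (-Complex.I) • Y) (X + (-Complex.I) • Y) := by
    rw [osCorr_add_smul hΘ hτ hXm hXb hYm hYb, osCorr_add_smul hΘ hτ hXm hXb hYm hYb,
      osCorr_add_smul hΘ hτ hXm hXb hYm hYb, osCorr_add_smul hΘ hτ hXm hXb hYm hYb]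
    simp only [map_one, map_neg, Complex.conj_I]
    linear_combination (2 * (osCorr μ Θ τ X Y - osCorr μ Θ τ Y X)) * Complex.I_mul_I
  have h1 := key 1 (by simp)
  have h2 := key (-1) (by simp)
  have h3 := key Complex.I (by simp)
  have h4 := key (-Complex.I) (by simp)
  have h4n : ‖(4 : ℂ) * osCorr μ Θ τ X Y‖ ≤ 4 * ((2 * osVar μ Θ X + 2 * osVar μ Θ Y) * E) := by
    rw [hpol]
    refine (norm_add_le _ _).trans ?_
    refine (add_le_add (norm_sub_le _ _) le_rfl).trans ?_
    refine (add_le_add (add_le_add (norm_sub_le _ _) le_rfl) le_rfl).trans ?_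
    simp only [norm_mul, Complex.norm_I, one_mul]
    linarith
  rw [norm_mul] at h4n
  have h4' : ‖(4 : ℂ)‖ = 4 := by simp
  rw [h4'] at h4n
  linarith

end Polarization

end Literature.MathematicalPhysics.QuantumLattice

end
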